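import Mathlib
import Summits.Ventures.PercRepro2.Defs
import Summits.Ventures.PercRepro2.Graph
import Summits.Ventures.PercRepro2.OneColourSwitch
import Summits.Ventures.PercRepro2.RegionHubSign
import Summits.Ventures.PercRepro2.SideSwitch
import Summits.Ventures.PercRepro2.SideSwitchM9
import Summits.Ventures.PercRepro2.SideSwitchClosed
import Summits.Ventures.PercRepro2.SideSwitchComps
import Summits.Ventures.PercRepro2.SideSwitchFibre
import Summits.Ventures.PercRepro2.TermSwitchDefs
import Summits.Ventures.PercRepro2.TermSwitchFibre
import Summits.Ventures.PercRepro2.TermSwitchCompsFibre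
import Summits.Ventures.PercRepro2.TermSwitchMono
import Summits.Ventures.PercRepro2.TermSwitchM9
import Summits.Ventures.PercRepro2.TermSwitchReach
import Summits.Ventures.PercRepro2.TermSwitchRestrict
import Summits.Ventures.PercRepro2.M9ReachedSum
import Summits.Ventures.PercRepro2.M9CornerHarris
import Summits.Ventures.PercRepro2.M9OneSidedFibre
import Summits.Ventures.PercRepro2.M9OneSidedFibreM
import Summits.Ventures.PercRepro2.M9OneSidedCorner
import Summits.Ventures.PercRepro2.M9OneSidedTEdge
import Summits.Ventures.PercRepro2.M9OneSidedTEdgeM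

import Summits.Ventures.PercRepro2.M9OneSidedTCorner

/-!
# The up-corner with a `T`-edge (blind cell PercRepro2, p3 g30, 2026-08-28; `proofs/P3-HDR.md` §12)

The mirror of the down-corner of `M9OneSidedTCorner`: with a `W` `T`-edge and no `Y` one
(`¬cK ∧ cM`) the one-sided points are the UP-corner `{T : J ⊆ T}`; a `Y`-connection `r ~ s`
there runs through unswitched blocks and becomes a `W`-connection after complementing the free
blocks (`conn_rs_up`), so `Σ σ_rs ≤ 0` (`up_corner_S_nonpos`), `Σ D ≥ 0`, and Harris on the
sub-cube gives the paired corner sum ≤ 0 (`up_corner_sum_nonpos`).  Own work; std axioms.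
-/

namespace Summit.Ventures.PercRepro2

namespace TermSwitch

open Finset Classical RegionHub OneColourSwitch SideSwitch

variable {V : Type*} {E : Type*}

section TCornerUp

variable [Fintype V] [DecidableEq V] [Fintype E] [DecidableEq E] {ends : E → Sym2 V} {p q r s d : V}

omit [Fintype E] [DecidableEq E] in
/-- **A `Y`-connection `r ~ s` on the up-corner becomes a `W`-connection after complementing
the free blocks**: it runs through unswitched blocks only. -/
lemma conn_rs_up (hT : TEdge ends r s d) {ρ : Config E}
    (hρ : ∀ x ∈ MH ends ({r, s, d} : Set V) ρ, x ∈ ({r, s, d} : Set V))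
    (hcK : ¬ cK ends r s d ρ) {T : Finset (Finset V)}
    (hTc : T ⊆ compsH ends ({r, s, d} : Set V) ρ) (hJT : joinSetT ends r s d ρ ⊆ T)
    (hc : Conn ends (assignC ends T ρ) r s) :
    Conn ends (OneColourSwitch.compl (assignC ends
      ((compsH ends ({r, s, d} : Set V) ρ \ T) ∪ joinSetT ends r s d ρ) ρ)) r s := by
  have hJA : joinSetT ends r s d ρ ⊆ compsH ends ({r, s, d} : Set V) ρ := Finset.filter_subset _ _
  have hT'A : (compsH ends ({r, s, d} : Set V) ρ \ T) ∪ joinSetT ends r s d ρ ⊆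
      compsH ends ({r, s, d} : Set V) ρ :=
    Finset.union_subset Finset.sdiff_subset hJA
  have hd : d ∈ ({r, s, d} : Set V) := d_mem_triple r s d
  have hr : r ∈ ({r, s, d} : Set V) := r_mem_triple r s d
  have hs : s ∈ ({r, s, d} : Set V) := s_mem_triple r s d
  have hdK : d ∉ K2 ends r s (assignC ends T ρ) := by
    rw [mem_K2_assignC_iff_joinsT hT hρ hTc]
    rintro (h | ⟨B, hB, hBT, hj⟩)
    · exact hcK h
    · exact hBT (hJT (Finset.mem_filter.2 ⟨hB, hj⟩))
  have hW : ∀ {e : E}, OneColourSwitch.compl (assignC ends ((compsH ends ({r, s, d} : Set V) ρ \ T) ∪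
      joinSetT ends r s d ρ) ρ) e = true ↔
      assignC ends ((compsH ends ({r, s, d} : Set V) ρ \ T) ∪ joinSetT ends r s d ρ) ρ e = false := by
    intro e; simp [OneColourSwitch.compl]
  -- an unswitched block is switched by the complement
  have hU' : ∀ {x : V}, (∃ B ∈ compsH ends ({r, s, d} : Set V) ρ, B ∉ T ∧ x ∈ B) →
      x ∈ unionT ((compsH ends ({r, s, d} : Set V) ρ \ T) ∪ joinSetT ends r s d ρ) := by
    rintro x ⟨B, hB, hBT, hxB⟩
    exact mem_unionT.2 ⟨B, Finset.mem_union_left _ (Finset.mem_sdiff.2 ⟨hB, hBT⟩), hxB⟩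
  have key : ∀ v, v ∈ {x | Conn ends (OneColourSwitch.compl (assignC ends
      ((compsH ends ({r, s, d} : Set V) ρ \ T) ∪ joinSetT ends r s d ρ) ρ)) r x ∧
      Conn ends (assignC ends T ρ) r x ∧
      (x = r ∨ x = s ∨ ∃ B ∈ compsH ends ({r, s, d} : Set V) ρ, B ∉ T ∧ x ∈ B)} → ∀ y,
      (openGraph ends (assignC ends T ρ)).Adj v y →
      y ∈ {x | Conn ends (OneColourSwitch.compl (assignC ends
        ((compsH ends ({r, s, d} : Set V) ρ \ T) ∪ joinSetT ends r s d ρ) ρ)) r x ∧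
        Conn ends (assignC ends T ρ) r x ∧
        (x = r ∨ x = s ∨ ∃ B ∈ compsH ends ({r, s, d} : Set V) ρ, B ∉ T ∧ x ∈ B)} := by
    intro v ⟨hv', hvc, hvt⟩ y hvy
    obtain ⟨hne, e, he, hends⟩ := openGraph_adj.1 hvy
    have hyc : Conn ends (assignC ends T ρ) r y := conn_trans hvc (conn_of_openAdj ⟨e, he, hends⟩)
    have hvH : v = r ∨ v = s → v ∈ ({r, s, d} : Set V) := by
      rintro (rfl | rfl) <;> simp
    have hterm : ∀ (hvH' : v ∈ ({r, s, d} : Set V)),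
        Conn ends (OneColourSwitch.compl (assignC ends
          ((compsH ends ({r, s, d} : Set V) ρ \ T) ∪ joinSetT ends r s d ρ) ρ)) r y ∧
        (y = r ∨ y = s ∨ ∃ B ∈ compsH ends ({r, s, d} : Set V) ρ, B ∉ T ∧ y ∈ B) := by
      intro hvH'
      by_cases hyH : y ∈ ({r, s, d} : Set V)
      · exfalso
        have hdr : ends e = s(d, r) := terminal_edge_cases hT hends hne hvH' hyH
        have hρe : ρ e = true := by
          rw [← assignC_eq_of_notMem (T := T) (ρ := ρ) hends (term_notMem_unionT hTc hvH')
            (term_notMem_unionT hTc hyH)]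
          exact he
        exact hcK ⟨e, Or.inl hdr, hρe⟩
      by_cases hyS : y ∈ KH ends ({r, s, d} : Set V) ρ ∪ MH ends ({r, s, d} : Set V) ρ
      · have hyA : y ∈ A0H ends ({r, s, d} : Set V) ρ := mem_A0H.2 ⟨hyS, hyH⟩
        obtain ⟨B, hB, hyB⟩ := exists_block_of_mem_A0H hyA
        have hρe : ρ e = true := edge_term_sided_true hρ hends hvH' hyH
        have hBT : B ∉ T := by
          intro hBT
          have hyU : y ∈ unionT T := mem_unionT.2 ⟨B, hBT, hyB⟩
          rw [assignC_eq_not_of_mem hends (Or.inr hyU), hρe] at he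
          exact absurd he (by decide)
        refine ⟨?_, Or.inr (Or.inr ⟨B, hB, hBT, hyB⟩)⟩
        have he' : OneColourSwitch.compl (assignC ends ((compsH ends ({r, s, d} : Set V) ρ \ T) ∪
            joinSetT ends r s d ρ) ρ) e = true := by
          rw [hW, assignC_eq_not_of_mem hends (Or.inr (hU' ⟨B, hB, hBT, hyB⟩)), hρe]
          rfl
        exact conn_trans hv' (conn_of_openAdj ⟨e, he', hends⟩)
      · exfalso
        have hρe : ρ e = false :=
          edge_KH_out_false hends (mem_KH_iff.2 ⟨v, hvH', conn_refl _ _ _⟩) (fun h => hyS (Or.inl h))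
        rw [assignC_eq_of_notMem hends (term_notMem_unionT hTc hvH') (out_notMem_unionT hTc hyS),
          hρe] at he
        exact absurd he (by decide)
    rcases hvt with hvr | hvs | ⟨B, hB, hBT, hvB⟩
    · obtain ⟨h1, h2⟩ := hterm (hvH (Or.inl hvr)); exact ⟨h1, hyc, h2⟩
    · obtain ⟨h1, h2⟩ := hterm (hvH (Or.inr hvs)); exact ⟨h1, hyc, h2⟩
    · have hvA : v ∈ A0H ends ({r, s, d} : Set V) ρ := subset_A0H_of_mem_compsH hB hvB
      have hvU : v ∉ unionT T := notMem_unionT_of_mem_of_notMem hTc hB hBT hvB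
      have hvU' : v ∈ unionT ((compsH ends ({r, s, d} : Set V) ρ \ T) ∪ joinSetT ends r s d ρ) :=
        hU' ⟨B, hB, hBT, hvB⟩
      by_cases hyH : y ∈ ({r, s, d} : Set V)
      · by_cases hyd : y = d
        · exfalso
          apply hdK
          rw [hyd] at hyc
          exact mem_K2_iff.2 (Or.inl hyc)
        have hyrs : y = r ∨ y = s := by
          simp only [Set.mem_insert_iff, Set.mem_singleton_iff] at hyH
          rcases hyH with h | h | h
          · exact Or.inl h
          · exact Or.inr h
          · exact absurd h hyd
        have hρe : ρ e = true := by
          rw [← assignC_eq_of_notMem (T := T) (ρ := ρ) hends hvU (term_notMem_unionT hTc hyH)]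
          exact he
        have he' : OneColourSwitch.compl (assignC ends ((compsH ends ({r, s, d} : Set V) ρ \ T) ∪
            joinSetT ends r s d ρ) ρ) e = true := by
          rw [hW, assignC_eq_not_of_mem hends (Or.inl hvU'), hρe]
          rfl
        refine ⟨conn_trans hv' (conn_of_openAdj ⟨e, he', hends⟩), hyc, ?_⟩
        rcases hyrs with h | h
        · exact Or.inl h
        · exact Or.inr (Or.inl h)
      by_cases hyS : y ∈ KH ends ({r, s, d} : Set V) ρ ∪ MH ends ({r, s, d} : Set V) ρ
      · have hyA : y ∈ A0H ends ({r, s, d} : Set V) ρ := mem_A0H.2 ⟨hyS, hyH⟩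
        have hyB : y ∈ B := mem_of_adj_of_mem_compsH hB hends hvB hyA
        have hyU : y ∉ unionT T := notMem_unionT_of_mem_of_notMem hTc hB hBT hyB
        have hρe : ρ e = true := by
          rw [← assignC_eq_of_notMem (T := T) (ρ := ρ) hends hvU hyU]; exact he
        have he' : OneColourSwitch.compl (assignC ends ((compsH ends ({r, s, d} : Set V) ρ \ T) ∪
            joinSetT ends r s d ρ) ρ) e = true := by
          rw [hW, assignC_eq_not_of_mem hends (Or.inl hvU'), hρe]
          rfl
        exact ⟨conn_trans hv' (conn_of_openAdj ⟨e, he', hends⟩), hyc,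
          Or.inr (Or.inr ⟨B, hB, hBT, hyB⟩)⟩
      · exfalso
        have hρe : ρ e = false :=
          edge_KH_out_false hends (mem_KH_of_mem_A0H hρ hvA) (fun h => hyS (Or.inl h))
        rw [assignC_eq_of_notMem hends hvU (out_notMem_unionT hTc hyS), hρe] at he
        exact absurd he (by decide)
  obtain ⟨h1, _, _⟩ := mem_of_conn_of_closed key ⟨conn_refl _ _ _, conn_refl _ _ _, Or.inl rfl⟩ hc
  exact h1

omit [Fintype V] [Fintype E] [DecidableEq E] in
/-- For `T' ⊆ A ∖ J` and `J ⊆ A`: `(A ∖ (T' ∪ J)) ∪ J = ((A ∖ J) ∖ T') ∪ J`. -/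
lemma sdiff_union_eq {A J T' : Finset (Finset V)} :
    (A \ (T' ∪ J)) ∪ J = ((A \ J) \ T') ∪ J := by
  ext B
  simp only [Finset.mem_union, Finset.mem_sdiff, not_or]
  constructor
  · rintro (⟨hBA, hBT, hBJ⟩ | hBJ)
    · exact Or.inl ⟨⟨hBA, hBJ⟩, hBT⟩
    · exact Or.inr hBJ
  · rintro (⟨⟨hBA, hBJ⟩, hBT⟩ | hBJ)
    · exact Or.inl ⟨hBA, hBT, hBJ⟩
    · exact Or.inr hBJ

omit [DecidableEq E] in
/-- **`Σ σ_rs ≤ 0` on the up-corner** (parametrised by the free part `T' ⊆ A ∖ J`). -/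
lemma up_corner_S_nonpos (hT : TEdge ends r s d) {ρ : Config E}
    (hρ : ∀ x ∈ MH ends ({r, s, d} : Set V) ρ, x ∈ ({r, s, d} : Set V))
    (hcK : ¬ cK ends r s d ρ) :
    ∑ T' ∈ (compsH ends ({r, s, d} : Set V) ρ \ joinSetT ends r s d ρ).powerset,
      sigma ends (assignC ends (T' ∪ joinSetT ends r s d ρ) ρ) r s ≤ 0 := by
  set A := compsH ends ({r, s, d} : Set V) ρ with hA
  set J := joinSetT ends r s d ρ
  have hJA : J ⊆ A := Finset.filter_subset _ _
  have hpt : ∀ T' ∈ (A \ J).powerset, sigma ends (assignC ends (T' ∪ J) ρ) r s +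
      sigma ends (assignC ends (((A \ J) \ T') ∪ J) ρ) r s ≤ 0 := by
    intro T' hT'
    have hTc : T' ⊆ A \ J := Finset.mem_powerset.1 hT'
    have hsub : ∀ S, S ⊆ A \ J → S ∪ J ⊆ A :=
      fun S hS => Finset.union_subset (fun B hB => (Finset.mem_sdiff.1 (hS hB)).1) hJA
    have h1 : Conn ends (assignC ends (T' ∪ J) ρ) r s →
        Conn ends (OneColourSwitch.compl (assignC ends (((A \ J) \ T') ∪ J) ρ)) r s := by
      intro h
      have := conn_rs_up hT hρ hcK (hsub T' hTc) Finset.subset_union_right h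
      rwa [sdiff_union_eq] at this
    have h2 : Conn ends (assignC ends (((A \ J) \ T') ∪ J) ρ) r s →
        Conn ends (OneColourSwitch.compl (assignC ends (T' ∪ J) ρ)) r s := by
      intro h
      have := conn_rs_up hT hρ hcK (hsub _ Finset.sdiff_subset) Finset.subset_union_right h
      rwa [sdiff_union_eq, Finset.sdiff_sdiff_eq_self hTc] at this
    unfold sigma
    split_ifs <;>
      first
      | exact absurd (h1 (by assumption)) (by assumption)
      | exact absurd (h2 (by assumption)) (by assumption)
      | norm_num
  have hsum : ∑ T' ∈ (A \ J).powerset, (sigma ends (assignC ends (T' ∪ J) ρ) r s +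
      sigma ends (assignC ends (((A \ J) \ T') ∪ J) ρ) r s) =
      2 * ∑ T' ∈ (A \ J).powerset, sigma ends (assignC ends (T' ∪ J) ρ) r s := by
    rw [Finset.sum_add_distrib,
      sum_powerset_sdiff (A \ J) (fun T' => sigma ends (assignC ends (T' ∪ J) ρ) r s)]
    ring
  have := Finset.sum_nonpos hpt
  linarith

/-- **The paired fibre sum over the up-corner is non-positive.** -/
theorem up_corner_sum_nonpos (hT : TEdge ends r s d) {ρ : Config E}
    (hρ : ρ ∈ RepH ends p q ({r, s, d} : Set V)) (hcK : ¬ cK ends r s d ρ) :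
    ∑ T' ∈ (compsH ends ({r, s, d} : Set V) ρ \ joinSetT ends r s d ρ).powerset,
      (sigma ends (assignC ends (T' ∪ joinSetT ends r s d ρ) ρ) p q +
        sigma ends (assignC ends (T' ∪ joinSetT ends r s d ρ) (flipOH ends ({r, s, d} : Set V) ρ)) p q) *
        sigma ends (assignC ends (T' ∪ joinSetT ends r s d ρ) ρ) r s ≤ 0 := by
  have hρM : ∀ x ∈ MH ends ({r, s, d} : Set V) ρ, x ∈ ({r, s, d} : Set V) := (mem_RepH.1 hρ).2
  have hr : r ∈ ({r, s, d} : Set V) := r_mem_triple r s d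
  set A := compsH ends ({r, s, d} : Set V) ρ with hA
  set J := joinSetT ends r s d ρ
  have hJA : J ⊆ A := Finset.filter_subset _ _
  have hsub : ∀ S, S ⊆ A \ J → S ∪ J ⊆ A :=
    fun S hS => Finset.union_subset (fun B hB => (Finset.mem_sdiff.1 (hS hB)).1) hJA
  let Yc : Finset (Finset V) → ℤ := fun T => if Conn ends (assignC ends T ρ) p q then 1 else 0
  let Yc' : Finset (Finset V) → ℤ := fun T =>
    if Conn ends (assignC ends T (flipOH ends ({r, s, d} : Set V) ρ)) p q then 1 else 0
  let G : Finset (Finset V) → ℤ := fun T => Yc T + Yc' T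
  let D' : Finset (Finset V) → ℤ := fun T' => G (T' ∪ J) - G (A \ (T' ∪ J))
  let S' : Finset (Finset V) → ℤ := fun T' => sigma ends (assignC ends (T' ∪ J) ρ) r s
  have hρO := flipOH_mem_RepH hρ
  have hmonoG : ∀ T T', T ⊆ T' → T' ⊆ A → G T ≤ G T' := by
    intro T T' hTT hT'
    have hT'O : T' ⊆ compsH ends ({r, s, d} : Set V) (flipOH ends ({r, s, d} : Set V) ρ) := by
      rw [compsH_flipOH]; exact hT'
    have h1 : Yc T ≤ Yc T' := ite_le_ite_of_imp (conn_pq_assignC_mono_H hρ hTT hT')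
    have h2 : Yc' T ≤ Yc' T' := ite_le_ite_of_imp (conn_pq_assignC_mono_H hρO hTT hT'O)
    simp only [G]; linarith
  have hmonoD' : ∀ T T', T ⊆ T' → T' ⊆ A \ J → D' T ≤ D' T' := by
    intro T T' hTT hT'
    have h1 := hmonoG (T ∪ J) (T' ∪ J) (Finset.union_subset_union hTT le_rfl) (hsub T' hT')
    have h2 := hmonoG (A \ (T' ∪ J)) (A \ (T ∪ J))
      (Finset.sdiff_subset_sdiff (Finset.Subset.refl A) (Finset.union_subset_union hTT le_rfl))
      Finset.sdiff_subset
    simp only [D']; linarith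
  have hantiS' : ∀ T T', T ⊆ T' → T' ⊆ A \ J → S' T' ≤ S' T := by
    intro T T' hTT hT'
    show sigma ends (assignC ends (T' ∪ J) ρ) r s ≤ sigma ends (assignC ends (T ∪ J) ρ) r s
    unfold sigma
    exact sub_le_sub
      (ite_le_ite_of_imp (conn_rs_assignC_anti_H hρ hr s (Finset.union_subset_union hTT le_rfl)
        (hsub T' hT')))
      (ite_le_ite_of_imp (conn_rs_compl_assignC_mono_H hρ hr s (Finset.union_subset_union hTT le_rfl)
        (hsub T' hT')))
  -- `Σ D' ≥ 0`: `Σ G(T' ∪ J) ≥ Σ G((A ∖ J) ∖ T') = Σ G(T')`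
  have hD0 : 0 ≤ ∑ T' ∈ (A \ J).powerset, D' T' := by
    simp only [D']
    rw [Finset.sum_sub_distrib]
    have h1 : ∑ T' ∈ (A \ J).powerset, G (A \ (T' ∪ J)) = ∑ T' ∈ (A \ J).powerset, G T' := by
      have : ∀ T' ∈ (A \ J).powerset, G (A \ (T' ∪ J)) = G ((A \ J) \ T') := by
        intro T' hT'
        congr 1
        ext B
        simp only [Finset.mem_sdiff, Finset.mem_union, not_or]
        constructor
        · rintro ⟨hBA, hBT, hBJ⟩; exact ⟨⟨hBA, hBJ⟩, hBT⟩
        · rintro ⟨⟨hBA, hBJ⟩, hBT⟩; exact ⟨hBA, hBT, hBJ⟩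
      rw [Finset.sum_congr rfl this, sum_powerset_sdiff (A \ J) G]
    have h2 : ∑ T' ∈ (A \ J).powerset, G T' ≤ ∑ T' ∈ (A \ J).powerset, G (T' ∪ J) :=
      Finset.sum_le_sum fun T' hT' => hmonoG T' (T' ∪ J) Finset.subset_union_left
        (hsub T' (Finset.mem_powerset.1 hT'))
    rw [h1]; linarith
  have hS0 : ∑ T' ∈ (A \ J).powerset, S' T' ≤ 0 := up_corner_S_nonpos hT hρM hcK
  have hH := harris_powerset (A \ J) D' (fun T' => - S' T') hmonoD'
    (fun T T' h1 h2 => by have := hantiS' T T' h1 h2; linarith)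
  simp only [Finset.sum_neg_distrib, mul_neg] at hH
  have hN : (0 : ℤ) < 2 ^ (A \ J).card := pow_pos two_pos _
  have hprod : (∑ T' ∈ (A \ J).powerset, D' T') * (∑ T' ∈ (A \ J).powerset, S' T') ≤ 0 :=
    mul_nonpos_of_nonneg_of_nonpos hD0 hS0
  have hDS : ∑ T' ∈ (A \ J).powerset, D' T' * S' T' ≤ 0 := by
    by_contra hcon
    have hpos : 0 < ∑ T' ∈ (A \ J).powerset, D' T' * S' T' := lt_of_not_ge hcon
    have := mul_pos hN hpos
    nlinarith
  refine le_trans (le_of_eq ?_) hDS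
  refine Finset.sum_congr rfl (fun T' hT' => ?_)
  rw [sigma_pq_add_flipOH_C hρ (hsub T' (Finset.mem_powerset.1 hT'))]

end TCornerUp

end TermSwitch

end Summit.Ventures.PercRepro2
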